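import Mathlib.Algebra.Order.AbsoluteValue.Basic
import Mathlib.Algebra.Ring.Aut
import Mathlib.Algebra.Field.Subfield.Basic
import Mathlib.Analysis.SpecialFunctions.Log.Basic
import Literature.IUT.HodgeArakelov.KummerPrimeStrips
import HarnessLib

/-!
# Joshi, *Arithmetic Teichmüller Spaces III* (arXiv:2401.13508v4) §8.5–§8.6: Rosetta Stone Fragment 3 — prime-strips
# à la Mochizuki from Joshi's data, realified prime-strips (8.6.1.1), Prop. 8.6.1.3 — TYPED, no side taken

Record file of the abc-iut cell, branch E «type Joshi's construction, test vs S» (rung LADDER-ABC:A2.E; seat abc-iut-E-t17,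
slot T-17; plan/E/t17/INVENTORY.tsv). Source: K. Joshi, *Construction of Arithmetic Teichmuller Spaces III: A ‘Rosetta
Stone’ and a proof of Mochizuki's Corollary 3.12*, «Preliminary version for comments», arXiv 2401.13508 **v4**, render
`HOME/lit/renders/Joshi-arxiv-2401.13508/pNNNN.txt` (PDF page = printed page; «p.N l.M» = line M of that page file); bib
`Joshi2024ATS3`. UNREFEREED, rejected by the IUT author [Mochizuki2024JoshiReport], accepted by neither side of the dispute:
everything is TYPED AS A CANDIDATE (D-0012); typed ≠ proved ≠ endorsed; nothing here asserts abc or [IUTchIII] Cor. 3.12;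
sentences Joshi ASSERTS are `Prop`-valued definitions tagged `@[claim "Joshi2024ATS3" "disputed"]` («disputed» records that a
dispute exists in print; no side) and are never asserted; PROVED is only what follows from the typed signature.

* §8.5 (p.81 l.8–57; table p.82) ROSETTA STONE FRAGMENT 3 compares, at a prime `v` of `L` (Mochizuki's `F`), `D = Π_v`,
  `D^⊢ = G_v`, `F = Π_v ↷ O^▷_v`, `F^⊢ = G_v ↷ O^×_v × q^ℕ`, `F^{⊢×} = G_v ↷ O^×_v`, `F^{⊢×μ} = G_v ↷ O^{×μ}_v`, `F^{⊢▶×μ} = G_v ↷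
  O^{×μ}_v × q^ℕ`, `F^{⊢▶} = G_v ↷ q^ℕ`, `F^{⊢⊥} = G_v ↷ O^{μ_{2ℓ}}_v × q^ℕ` ([IUTchI, Fig. I1.2]) with what the holomorphoid
  `hol_{X/L_v}(ℂ♭_{p_v})_{y_v} = (X/L_v, X/K_v)`, `K♭_v = ℂ♭_p`, provides: `Π^temp_{(X/L_v,X/K_v)}`, `G_{L_v;K_v}` = «the absolute
  Galois group of `L̄_v/L_v`, `L̄_v` the algebraic closure of `L_v` in `K_v`» (p.83 l.26–27) acting on `O_{L̄_v}`, `O^×`,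
  `O^{×μ} = O^×/μ(L̄)`, and the Tate quasi-period `q_{(X/L_v,X/K_v)}` (p.83 l.45 – p.84 l.2). TYPED as the SIGNATURE
  `StripDatum` (§1; carriers are type parameters — no instance declared) and the right column as DEFINITIONS (§2) in OUR
  [IUTchII] Def. 4.9 vocabulary BY NAME — `Literature.IUT.HodgeArakelov.CoveringMonoid` («`G ↷ O^▷(A)`»), `.unitsAct`,
  `.unitsModTorsionAct`, `UnitsModTorsion` (`O^{×μ}`), `OPerp` (`O^⊥ = ⟨μ_{2l}, splitting⟩`) — so the dictionary rows `F^{⊢×} /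
  F^{⊢×μ} / F^{⊢▶×μ} / F^{⊢⊥}` are DEFINITIONAL; the `G`-stability of `O^▷`, `q^ℕ`, `O^⊥` is DERIVED. §8.6 (p.83): (8.6.1)
  `F^?_{Joshi}(X/L_v,X/K_v)`; (8.6.3) `F^{⊢×μ}_{Joshi} = G_{L_v} ↷ O^{×μ}_{L̄_v}`; (8.6.5) `F^{⊢▶×μ}_{Joshi} = G_{L_v} ↷ O^{×μ}_{L̄_v} ×
  q^ℕ_{(X/L_v,X/K_v)}`. §8.6.1 (p.84): the REALIFIED strip (8.6.1.1) `F^{|?}_{Joshi} := (F^?_{Joshi}, |−|_{K_{y_v}})` — `Realified`,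
  `absTate`, `log|q| < 0` PROVED (§3); Rmk. 8.6.1.2 quoted. Prop. 8.6.1.3 (p.85 l.1–15, «an isomorph of Mochizuki's
  prime-strip … many … distinguishable prime-strips») = claim-Prop `IsomorphsOfModel` over `StripIso` (§4); Rmk. 8.6.1.4
  quoted (attach point of [Mochizuki2024JoshiReport] (ShtAns); no side). §5 PROVES the functoriality clause that Thm. 8.8.3
  (sequel file `RosettaFragment4Gluing.lean`) invokes: an isomorphism of the field-level data induces (8.8.4).
* Dictionary to OUR typed interface (branch-E row E3; FQNs imported BY NAME, never restated; DEFS-FREEZE respected — no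
  carrier of the frozen Cor. 3.12 files is reused): `F` ↔ `Literature.IUT.HodgeTheaters.PMBaseKit.FKit.FStrip`; `D` ↔
  `….PMBaseKit.DStrip`; `F^⊢` ↔ `….FKit.FmStrip`; `F^{⊢×}` ↔ `CoveringMonoid.unitsAct` / `KummerTimes`; `F^{⊢×μ}` ↔
  `CoveringMonoid.unitsModTorsionAct`, `FTimesMuPrimeStrip`; `F^{⊢▶×μ}` ↔ `OTriTimesMu`, `FTriMuPrimeStrip`; `F^{⊢⊥}` ↔ `OPerp`;
  realified `F^{⊩▶×μ}` ↔ `FVdashTriMuPrimeStrip` (Joshi's `|−|_{K_{y_v}}` in the role of `ρ_v`; `log|q|` the pilot degree at `v`).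
  Merge-debt: `Π`, `G`, the holomorphoid index = E-t1 / T-16 carriers; `K_v`, `|−|_{K_{y_v}}` = E-t3's `PeriodRingDatum.K/absK`.
  Deliberately NOT here: holomorphoids / `𝒴_L` themselves, Frobenioids (§10.2), §8.7–§8.8 (sequel file), any test against
  `S`, any judgement. [claim: Joshi2024ATS3, status: disputed]
-/

namespace Summit.ABC.IUTFork.Joshi.ATS3

open Literature.IUT.HodgeArakelov

universe u

/-! ## 1. §8.5: the datum a holomorphoid provides at `v` (signature of Rosetta Stone Fragment 3, right column) -/

/-- **SIGNATURE `StripDatum`** — what the local holomorphoid `hol_{X/L_v}(ℂ♭_{p_v})_{y_v} = (X/L_v, X/K_v)` provides at a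
prime `v` of `L` for Rosetta Stone Fragment 3 ([J-III] §8.5 p.81 l.8–57, table p.82; §8.6 p.83 l.26–27, l.45 – p.84 l.2;
§8.6.1 p.84 l.3–9), over carrier TYPES given as parameters (no instance declared): `Pi` = the tempered fundamental group
`Π^temp_{(X/L_v,X/K_v)}` («`≃ Π^temp_{(X/L_v,X/ℂ_{p_v})}`», p.82 l.7–11); `G` = `G_{L_v;K_v}` «the absolute Galois group of
`L̄_v/L_v`» (p.83 l.26), a quotient of `Pi` (`proj`, row `D ⊢ G_v`, p.82 l.12); `Lbar` = `L̄_v` «the algebraic closure of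
`L_v` in `K_v`» with `Lv ⊆ L̄_v` the completion `L_v` (p.81 l.27–29) and the Galois action `gal` fixing `L_v`; `Kv` = the
perfectoid field `K_v = K_{y_v}` with `emb : L̄_v ↪ K_{y_v}` (p.84 l.8–9) and the valuation `|−|_{K_{y_v}} : K_{y_v} → ℝ`
«provide[d] by [Fargues and Fontaine, 2018]» (p.84 l.5–7; real-valued as in arXiv 2303.01662 Prop. 2.7.1); the induced
`|−|_{L̄_v}` is Galois-invariant (`abs_gal`: the classical uniqueness of the extension of `|−|_v` from the complete field
`L_v` to its algebraic closure — a FIELD here, used implicitly p.82 when `G` acts on `O_{L̄_v}`); `q` = «the Tate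
quasi-period of the projective Tate elliptic curve `C/L_v` underlying `X/L_v`» (p.83 l.45 – p.84 l.2), an element of
`L_v` with `0 < |q| < 1` (Tate curve); `ell` = the prime `ℓ` of the initial theta data (§3.3) entering the row
`F^{⊢⊥} = G_v ↷ O^{μ_{2ℓ}}_v × q^ℕ` (p.82 l.45–50). HYPOTHESIS structure: nothing is asserted; never instantiated here.
[claim: Joshi2024ATS3, status: disputed] -/
structure StripDatum (Pi G Lbar Kv : Type) [Group Pi] [Group G] [Field Lbar] [Field Kv] where
  /-- `Π^temp_{(X/L_v,X/K_v)} ↠ G_{L_v;K_v}` (row `D ⊢ G_v`, p.82 l.12) -/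
  proj : Pi →* G
  /-- it is a quotient map -/
  proj_surjective : Function.Surjective proj
  /-- `L̄_v ⊂ K_v = K_{y_v}` (p.82 l.6, p.84 l.8–9) -/
  emb : Lbar →+* Kv
  /-- `L_v ⊂ L̄_v`, the completion of `L` at `v` (p.81 l.27; p.83 l.25) -/
  Lv : Subfield Lbar
  /-- `G_{L_v;K_v} = Gal(L̄_v/L_v)` acting on `L̄_v` (p.83 l.26) -/
  gal : G →* RingAut Lbar
  /-- the Galois action fixes `L_v` pointwise -/
  gal_fix : ∀ (g : G) (x : Lbar), x ∈ Lv → gal g x = x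
  /-- `|−|_{K_{y_v}} : K_{y_v} → ℝ` provided by the point `y_v ∈ Y_{ℂ♭_p,L_v}` ([FF18]; p.84 l.5–7, l.34–36) -/
  absK : AbsoluteValue Kv ℝ
  /-- `|σ(x)|_{L̄_v} = |x|_{L̄_v}` for `σ ∈ G_{L_v;K_v}`, `x ∈ L̄_v` (uniqueness of the extended valuation) -/
  abs_gal : ∀ (g : G) (x : Lbar), absK (emb (gal g x)) = absK (emb x)
  /-- the Tate quasi-period `q_{(X/L_v,X/K_v)}` of `C/L_v` (p.83 l.45 – p.84 l.2) -/
  q : Lbar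
  /-- `q ∈ L_v` -/
  q_mem : q ∈ Lv
  /-- `0 < |q|_{K_{y_v}}` (`q ≠ 0`) -/
  absK_q_pos : 0 < absK (emb q)
  /-- `|q|_{K_{y_v}} < 1` (Tate curve) -/
  absK_q_lt_one : absK (emb q) < 1
  /-- the prime `ℓ` of §3.3 (row `F^{⊢⊥}`, `μ_{2ℓ}`) -/
  ell : ℕ

namespace StripDatum

variable {Pi G Lbar Kv : Type} [Group Pi] [Group G] [Field Lbar] [Field Kv] (D : StripDatum Pi G Lbar Kv)

/-- `|−|_{L̄_v}`: the valuation of `L̄_v ⊂ K_{y_v}` induced by `|−|_{K_{y_v}}` ([J-III] §8.6.1 p.84 l.7–9).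
[claim: Joshi2024ATS3, status: disputed] -/
def absL : AbsoluteValue Lbar ℝ where
  toFun x := D.absK (D.emb x)
  map_mul' x y := by simp only [map_mul]
  nonneg' x := D.absK.nonneg _
  eq_zero' x := ⟨fun h => D.emb.injective (by simpa using (D.absK.eq_zero).1 h), fun h => by simp [h]⟩
  add_le' x y := by simpa only [map_add] using D.absK.add_le (D.emb x) (D.emb y)

/-- `|x|_{L̄_v} = |emb x|_{K_{y_v}}` (by definition). [claim: Joshi2024ATS3, status: disputed] -/
@[simp] theorem absL_apply (x : Lbar) : D.absL x = D.absK (D.emb x) := rfl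

/-- DERIVED: the Galois action preserves `|−|_{L̄_v}`. [claim: Joshi2024ATS3, status: disputed] -/
theorem absL_gal (g : G) (x : Lbar) : D.absL (D.gal g x) = D.absL x := D.abs_gal g x

/-- DERIVED: `σ(q) = q` for `σ ∈ G_{L_v;K_v}` (`q ∈ L_v`). [claim: Joshi2024ATS3, status: disputed] -/
theorem gal_q (g : G) : D.gal g D.q = D.q := D.gal_fix g D.q D.q_mem

/-- DERIVED: `σ⁻¹(σ(x)) = x`. [claim: Joshi2024ATS3, status: disputed] -/
theorem gal_inv_apply (g : G) (x : Lbar) : D.gal g⁻¹ (D.gal g x) = x := by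
  rw [← RingAut.mul_apply, ← map_mul, inv_mul_cancel, map_one, RingAut.one_apply]

/-- DERIVED: `σ(σ⁻¹(x)) = x`. [claim: Joshi2024ATS3, status: disputed] -/
theorem gal_apply_inv (g : G) (x : Lbar) : D.gal g (D.gal g⁻¹ x) = x := by
  rw [← RingAut.mul_apply, ← map_mul, mul_inv_cancel, map_one, RingAut.one_apply]

/-! ## 2. Rosetta Stone Fragment 3, right column (p.82): the monoids and the prime-strips `F^?_{Joshi}` (§8.6) -/

/-- `O^▷_{L̄_v}`: the multiplicative monoid of non-zero `v`-integers of `L̄_v`, `{x ≠ 0, |x|_{L̄_v} ≤ 1}` (row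
`F : Π_v ↷ O^▷_v | Π^temp ↷ O_{L̄_v}`, p.82 l.13–16; «`O_{L̄_v}` is the integral closure of `O_v` in `L̄_v`», p.81 l.41).
[claim: Joshi2024ATS3, status: disputed] -/
def OTri : Submonoid Lbar where
  carrier := {x | x ≠ 0 ∧ D.absL x ≤ 1}
  one_mem' := ⟨one_ne_zero, by simp⟩
  mul_mem' := by
    rintro x y ⟨hx0, hx⟩ ⟨hy0, hy⟩
    exact ⟨mul_ne_zero hx0 hy0, by rw [map_mul]; exact mul_le_one₀ hx (D.absL.nonneg y) hy⟩

/-- Membership in `O^▷_{L̄_v}`. [claim: Joshi2024ATS3, status: disputed] -/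
theorem mem_OTri (x : Lbar) : x ∈ D.OTri ↔ x ≠ 0 ∧ D.absL x ≤ 1 := Iff.rfl

/-- DERIVED: `O^▷_{L̄_v}` is Galois-stable (from `abs_gal`). [claim: Joshi2024ATS3, status: disputed] -/
theorem gal_mem_OTri (g : G) {x : Lbar} (hx : x ∈ D.OTri) : D.gal g x ∈ D.OTri := by
  refine ⟨fun h => hx.1 ?_, by rw [D.absL_gal]; exact hx.2⟩
  simpa only [gal_inv_apply, map_zero] using congrArg (D.gal g⁻¹) h

/-- The action of `σ ∈ G_{L_v;K_v}` on `O^▷_{L̄_v}` by monoid automorphisms (restriction of the Galois action).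
[claim: Joshi2024ATS3, status: disputed] -/
def galOTri (g : G) : MulAut D.OTri where
  toFun x := ⟨D.gal g x, D.gal_mem_OTri g x.2⟩
  invFun x := ⟨D.gal g⁻¹ x, D.gal_mem_OTri g⁻¹ x.2⟩
  left_inv x := Subtype.ext (D.gal_inv_apply g x)
  right_inv x := Subtype.ext (D.gal_apply_inv g x)
  map_mul' x y := Subtype.ext (by simp only [Submonoid.coe_mul, map_mul])

/-- Value of the restricted action. [claim: Joshi2024ATS3, status: disputed] -/
@[simp] theorem coe_galOTri (g : G) (x : D.OTri) : (D.galOTri g x : Lbar) = D.gal g x := rfl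

/-- `G_{L_v;K_v} ↷ O^▷_{L̄_v}` as a homomorphism to monoid automorphisms. [claim: Joshi2024ATS3, status: disputed] -/
def actOTri : G →* MulAut D.OTri where
  toFun := D.galOTri
  map_one' := by
    refine MulEquiv.ext fun x => Subtype.ext ?_
    simp only [coe_galOTri, map_one, RingAut.one_apply, MulAut.one_apply]
  map_mul' g h := by
    refine MulEquiv.ext fun x => Subtype.ext ?_
    simp only [coe_galOTri, map_mul, RingAut.mul_apply, MulAut.mul_apply]

/-- **The basic pair `G_{L_v;K_v} ↷ O^▷_{L̄_v}`** in OUR [IUTchII] Def. 4.9 (i) shape `G ↷ O^▷(A)` (`CoveringMonoid`), from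
which the rows `F^{⊢×}`, `F^{⊢×μ}` are read off by OUR passages to units / units-mod-torsion. [claim: Joshi2024ATS3, status: disputed] -/
def coveringMonoid : CoveringMonoid G where
  O := D.OTri
  act := D.actOTri

/-- Row **`F`** (holomorphic prime-strip): `Π_v ↷ O^▷_v` | `Π^temp_{X/L_v;K_v} ↷ O_{L̄_v}` (p.82 l.13–16), the tempered
group acting through its quotient `G_{L_v;K_v}`. Dictionary: `Literature.IUT.HodgeTheaters.PMBaseKit.FKit.FStrip`
([IUTchI] Def. 5.2 (i)). [claim: Joshi2024ATS3, status: disputed] -/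
def stripHol : CoveringMonoid Pi where
  O := D.OTri
  act := D.actOTri.comp D.proj

/-- Row **`F^{⊢×}`**: `G_v ↷ O^×_v` | `G_{L_v;K_v} ↷ O^×_{L̄_v}` (p.82 l.25–31) = OUR `CoveringMonoid.unitsAct`
(«`O^×(A)` … with natural `G`-actions», [IUTchII] Def. 4.9 (i)). [claim: Joshi2024ATS3, status: disputed] -/
def stripTimes : G →* MulAut (D.OTri)ˣ := D.coveringMonoid.unitsAct

/-- Row **`F^{⊢×μ}`** = (8.6.3) `F^{⊢×μ}_{Joshi}(X/L_v,X/K_v) = G_{L_v} ↷ O^{×μ}_{L̄_v}`, `O^{×μ} = O^×/μ(L̄)` (p.82 l.32–36,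
p.83 l.19–27) = OUR `CoveringMonoid.unitsModTorsionAct` on `UnitsModTorsion` ([IUTchII] Def. 4.9 (i),(vi): the local
datum of an `F^{⊢×μ}`-prime-strip). [claim: Joshi2024ATS3, status: disputed] -/
def stripTimesMu : G →* MulAut (UnitsModTorsion D.OTri) := D.coveringMonoid.unitsModTorsionAct

/-- `q^ℕ_{(X/L_v,X/K_v)}`: the monoid of powers of the Tate quasi-period inside `L̄_v` (p.82 l.19–23, (8.6.5)).
[claim: Joshi2024ATS3, status: disputed] -/
def qPowers : Submonoid Lbar := Submonoid.powers D.q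

/-- DERIVED: `q ∈ O^▷_{L̄_v}` (`q ≠ 0`, `|q| < 1`). [claim: Joshi2024ATS3, status: disputed] -/
theorem q_mem_OTri : D.q ∈ D.OTri := by
  refine ⟨fun h => ?_, le_of_lt (by simpa using D.absK_q_lt_one)⟩
  have := D.absK_q_pos
  rw [h, map_zero, map_zero] at this
  exact lt_irrefl _ this

/-- DERIVED: `q^ℕ ⊆ O^▷_{L̄_v}`. [claim: Joshi2024ATS3, status: disputed] -/
theorem qPowers_le_OTri : D.qPowers ≤ D.OTri :=
  (Submonoid.powers_le).2 D.q_mem_OTri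

/-- DERIVED: `q^ℕ` is fixed pointwise by `G_{L_v;K_v}` (the factor `× q^ℕ` carries the trivial action).
[claim: Joshi2024ATS3, status: disputed] -/
theorem gal_eq_self_of_mem_qPowers (g : G) {x : Lbar} (hx : x ∈ D.qPowers) : D.gal g x = x := by
  obtain ⟨n, rfl⟩ := (Submonoid.mem_powers_iff _ _).1 hx
  rw [map_pow, D.gal_q]

/-- Inflating an action `G ↷ A` to `G ↷ A × B` with the trivial action on `B` (the shape of the rows «`… × q^ℕ`»).
[folklore] -/
def inflate {A B : Type} [Mul A] [Mul B] (ρ : G →* MulAut A) : G →* MulAut (A × B) where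
  toFun g :=
    { toFun := fun x => (ρ g x.1, x.2)
      invFun := fun x => ((ρ g).symm x.1, x.2)
      left_inv := fun x => Prod.ext ((ρ g).symm_apply_apply x.1) rfl
      right_inv := fun x => Prod.ext ((ρ g).apply_symm_apply x.1) rfl
      map_mul' := fun x y => Prod.ext (map_mul (ρ g) x.1 y.1) rfl }
  map_one' := by
    refine MulEquiv.ext fun x => Prod.ext ?_ rfl
    show (ρ 1) x.1 = x.1
    rw [map_one]
    rfl
  map_mul' g h := by
    refine MulEquiv.ext fun x => Prod.ext ?_ rfl
    show (ρ (g * h)) x.1 = (ρ g) ((ρ h) x.1)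
    rw [map_mul]
    rfl

/-- Row **`F^⊢`** (mono-analytic prime-strip): `G_v ↷ O^×_v × q^ℕ` | `G_{L_v;K_v} ↷ O^×_{L̄_v} × q^ℕ_{(X/L_v,X/K_v)}`
(p.82 l.17–24). Dictionary: `Literature.IUT.HodgeTheaters.PMBaseKit.FKit.FmStrip` ([IUTchI] Def. 5.2 (ii)).
[claim: Joshi2024ATS3, status: disputed] -/
def stripMono : CoveringMonoid G where
  O := (D.OTri)ˣ × D.qPowers
  act := inflate D.stripTimes

/-- Row **`F^{⊢▶×μ}`** = (8.6.5) `F^{⊢▶×μ}_{Joshi}(X/L_v,X/K_v) = G_{L_v} ↷ O^{×μ}_{L̄_v} × q^ℕ_{(X/L_v,X/K_v)}` (p.82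
l.37–42, p.83 l.33–47) — the type along which Mochizuki glues (§8.8 (8.8.1)). Dictionary: OUR
`Literature.IUT.HodgeArakelov.OTriTimesMu` = `O^▶ × O^{×μ}` and `FTriMuPrimeStrip` ([IUTchII] Def. 4.9 (ii),(vi)–(vii)),
with `q^ℕ` in the role of `O^▶ ≅ ℕ`. [claim: Joshi2024ATS3, status: disputed] -/
def stripTriTimesMu : CoveringMonoid G where
  O := UnitsModTorsion D.OTri × D.qPowers
  act := inflate D.stripTimesMu

/-- Row **`F^{⊢▶}`**: `G_v ↷ q^ℕ` | `G_{L_v;K_v} ↷ q^ℕ_{(X/L_v,X/K_v)}` (p.82 l.43–44), trivial action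
(`gal_eq_self_of_mem_qPowers`). [claim: Joshi2024ATS3, status: disputed] -/
def stripTri : CoveringMonoid G where
  O := D.qPowers
  act := 1

/-- `q^ℕ` as a submonoid of `O^▷_{L̄_v}` (the «splitting» of OUR `OPerp`). [claim: Joshi2024ATS3, status: disputed] -/
def qPowersIn : Submonoid D.OTri := Submonoid.powers ⟨D.q, D.q_mem_OTri⟩

/-- Row **`F^{⊢⊥}`**: `G_v ↷ O^{μ_{2ℓ}}_v × q^ℕ` | `G_{L_v;K_v} ↷ O^{μ_{2ℓ}}_{L̄_v} × q^ℕ_{(X/L_v,X/K_v)}` (p.82 l.45–50): the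
carrier is OUR `Literature.IUT.HodgeArakelov.OPerp O^▷ (2ℓ) q^ℕ` = `⟨μ_{2ℓ}, q^ℕ⟩ ⊆ O^▷` ([IUTchII] Def. 4.9 (ii) `O^⊥`),
DEFINITIONALLY. [claim: Joshi2024ATS3, status: disputed] -/
def stripPerp : Submonoid D.OTri := OPerp D.OTri (2 * D.ell) D.qPowersIn

/-- DERIVED: the `F^{⊢⊥}` carrier `⟨μ_{2ℓ}, q^ℕ⟩` is `G_{L_v;K_v}`-stable (roots of unity go to roots of unity, `q` is
fixed). [claim: Joshi2024ATS3, status: disputed] -/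
theorem actOTri_mem_stripPerp (g : G) {x : D.OTri} (hx : x ∈ D.stripPerp) : D.actOTri g x ∈ D.stripPerp := by
  rw [stripPerp, OPerp, Submonoid.mem_sup] at hx ⊢
  obtain ⟨y, hy, z, hz, rfl⟩ := hx
  obtain ⟨ζ, hζ, rfl⟩ := hy
  refine ⟨D.actOTri g (Units.coeHom _ ζ), ?_, D.actOTri g z, ?_, by rw [map_mul]⟩
  · refine ⟨Units.map (D.actOTri g).toMonoidHom ζ, ?_, rfl⟩
    simp only [SetLike.mem_coe, Subgroup.mem_toSubmonoid, mem_rootsOfUnity] at hζ ⊢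
    rw [← map_pow, hζ, map_one]
  · obtain ⟨n, rfl⟩ := (Submonoid.mem_powers_iff _ _).1 hz
    refine (Submonoid.mem_powers_iff _ _).2 ⟨n, ?_⟩
    rw [map_pow]
    congr 1
    exact Subtype.ext (by simp [actOTri, D.gal_q])

/-! ## 3. §8.6.1: realified prime-strips (8.6.1.1) and the absolute value of the Tate parameter -/

/-- **(8.6.1.1) realified prime-strip** `F^{|?}_{Joshi}(hol(X/L_v)_{y_v}) := (F^?_{Joshi}, |−|_{K_{y_v}} : K_{y_v} → ℝ)`:
«the prime-strip … plus the valuation … given by [Fargues and Fontaine, 2018] which allows us to compute absolute values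
of elements of `L̄_v ⊂ K_{y_v}`» ([J-III] §8.6.1 p.84 l.10–38; Mochizuki's bar convention [IUTchI, Table I1.2]). Generic
in the strip type `X`. Dictionary: OUR `Literature.IUT.HodgeArakelov.FVdashTriMuPrimeStrip` records instead
`ρ_v : O^▶ →* ℝ_{≥0}` and the pilot object's local degree; Rmk. 8.6.1.2 (p.84 l.39–42): «Mochizuki's method of keeping
track of valuations is through the notion of realified Frobenioids. By … §10.2, one can use the given valuation … to
obtain the relevant realified frobenioid.» [claim: Joshi2024ATS3, status: disputed] -/
structure Realified (X : Type u) (Kv : Type) [Field Kv] where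
  /-- the prime-strip `F^?_{Joshi}` -/
  strip : X
  /-- the valuation `|−|_{K_{y_v}}` -/
  abs : AbsoluteValue Kv ℝ

/-- `F^? ↦ F^{|?}`: realify any Fragment-3 row of the datum by adjoining `|−|_{K_{y_v}}` ((8.6.1.1), p.84 l.10–18).
[claim: Joshi2024ATS3, status: disputed] -/
def realify {X : Type u} (row : StripDatum Pi G Lbar Kv → X) : Realified X Kv := ⟨row D, D.absK⟩

/-- The realified `F^{⊩▶×μ}_{Joshi}(X/L_v,X/K_{y_v}) = (F^{⊢▶×μ}_{Joshi}, |−|_{K_{y_v}})` (p.84 l.19–35).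
[claim: Joshi2024ATS3, status: disputed] -/
def stripVdashTriTimesMu : Realified (CoveringMonoid G) Kv := D.realify stripTriTimesMu

/-- `|q_{(X/L_v,X/K_{y_v})}|_{K_{y_v}}`: «in particular calculate the absolute value of the Tate parameter» (p.84 l.37–38).
[claim: Joshi2024ATS3, status: disputed] -/
def absTate : ℝ := D.absK (D.emb D.q)

/-- DERIVED: `0 < |q| < 1`. [claim: Joshi2024ATS3, status: disputed] -/
theorem absTate_pos_lt_one : 0 < D.absTate ∧ D.absTate < 1 := ⟨D.absK_q_pos, D.absK_q_lt_one⟩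

/-- DERIVED: `log |q|_{K_{y_v}} < 0` — the realified strip's `q`-degree is negative (cf. OUR
`FVdashTriMuPrimeStrip.pilot_deg_neg`). [claim: Joshi2024ATS3, status: disputed] -/
theorem log_absTate_neg : Real.log D.absTate < 0 := Real.log_neg D.absK_q_pos D.absK_q_lt_one

/-- DERIVED: units of `O^▷_{L̄_v}` have absolute value `1`, so `|−|_{L̄_v}` is read on `O^▷/O^× = O^▶` (the shape of OUR
`FVdashTriMuPrimeStrip.rho`). [claim: Joshi2024ATS3, status: disputed] -/
theorem absL_unit (u : (D.OTri)ˣ) : D.absL (u : D.OTri) = 1 := by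
  have h1 : D.absL ((u : D.OTri) : Lbar) * D.absL ((u⁻¹ : (D.OTri)ˣ) : D.OTri) = 1 := by
    rw [← map_mul, ← Submonoid.coe_mul, Units.mul_inv, Submonoid.coe_one, map_one]
  have hu := (u : D.OTri).2.2
  have hu' := ((u⁻¹ : (D.OTri)ˣ) : D.OTri).2.2
  nlinarith [D.absL.nonneg ((u : D.OTri) : Lbar), D.absL.nonneg (((u⁻¹ : (D.OTri)ˣ) : D.OTri) : Lbar)]

end StripDatum

/-! ## 4. Strip isomorphisms; Proposition 8.6.1.3 (isomorphs of Mochizuki's prime-strips) -/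

/-- An **isomorphism of `G ↷ M` data** with possibly different groups: a group isomorphism and an equivariant monoid
isomorphism — the notion under which Prop. 8.6.1.3 speaks of «an isomorph of Mochizuki's prime-strip» and Thm. 8.8.3
of «an isomorphism of each of the prime-strips» ((8.8.4): `G_{L_v} ↷ O^{×μ}_{L̄_v} ⥲ G_{L^σ_v} ↷ O^{×μ}_{L̄^σ_v}`, p.89
l.4–13). (OUR same-`G` version: `Literature.IUT.HodgeArakelov.EquivariantIso`.) [claim: Joshi2024ATS3, status: disputed] -/
structure StripIso {G G' : Type} [Group G] [Group G'] (S : CoveringMonoid G) (S' : CoveringMonoid G') where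
  /-- `G ≃ G'` -/
  groupIso : G ≃* G'
  /-- `M ≃ M'` -/
  monoidIso : S.O ≃* S'.O
  /-- equivariance -/
  map_act : ∀ (g : G) (x : S.O), monoidIso (S.act g x) = S'.act (groupIso g) (monoidIso x)

/-- **PROPOSITION 8.6.1.3**, typed ([J-III] p.85 l.1–15): «Each holomorphoid `hol(X/L)_y` with `y = {y_v}_{v ∈ V_L}`
provides (for each `v ∈ V_L`) an isomorph, `F^?_{Joshi}(X/L_v)_{y_v}`, of Mochizuki's prime-strip `F^?_{Mochizuki,L_v}` (as in
Rosetta Stone Fragment 3) and also an isomorph `F^{|?}_{Joshi}(X/L_v)_{y_v}` of the corresponding realified prime-strip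
`F^{|?}_{Mochizuki,L_v}` … In particular, there are many geometrically and arithmetically distinguishable prime-strips in
[Mochizuki, 2021a,b,c].» For a family `J` of `G_y ↷ M_y` data indexed by holomorphoids `y : Hol` and a reference
model `F^?_{Mochizuki,L_v}`: every member is isomorphic to the model (the shape of OUR
`Literature.IUT.HodgeTheaters.PMBaseKit.FKit.FStrip.isModel`). Rmk. 8.6.1.4 (p.85 l.16–19): «distinct (but abstractly
isomorphic) prime-strips … needed in the proofs of [IUTchIII, Thm. 3.11 / Cor. 3.12]» — quoted, no side. CLAIM,
never asserted. [claim: Joshi2024ATS3, status: disputed] -/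
@[claim "Joshi2024ATS3" "disputed"]
def IsomorphsOfModel {Hol : Type} {G : Hol → Type} [∀ y, Group (G y)] (J : ∀ y, CoveringMonoid (G y))
    {G₀ : Type} [Group G₀] (model : CoveringMonoid G₀) : Prop :=
  ∀ y, Nonempty (StripIso (J y) model)


/-! ## 5. Isomorphisms of Fragment-3 data induce strip isomorphisms (the provable clause behind (8.8.4)) -/

/-- An **isomorphism of Fragment-3 data** at the field level: `φ : G ≃ G'` and a ring isomorphism `ψ : L̄_v ≃ L̄'_v`
intertwining the Galois actions and the valuations (what a `Π`-isomorphism is claimed to «provide»).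
[claim: Joshi2024ATS3, status: disputed] -/
structure DatumIso {Pi G Lbar Kv Pi' G' Lbar' Kv' : Type} [Group Pi] [Group G] [Field Lbar] [Field Kv]
    [Group Pi'] [Group G'] [Field Lbar'] [Field Kv'] (D : StripDatum Pi G Lbar Kv) (D' : StripDatum Pi' G' Lbar' Kv')
    where
  /-- `G_{L_v} ≃ G_{L^σ_v}` -/
  groupIso : G ≃* G'
  /-- `L̄_v ≃ L̄^σ_v` -/
  fieldIso : Lbar ≃+* Lbar'
  /-- it intertwines the Galois actions -/
  map_gal : ∀ (g : G) (x : Lbar), fieldIso (D.gal g x) = D'.gal (groupIso g) (fieldIso x)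
  /-- it is isometric -/
  map_abs : ∀ x : Lbar, D'.absL (fieldIso x) = D.absL x

namespace DatumIso

variable {Pi G Lbar Kv Pi' G' Lbar' Kv' : Type} [Group Pi] [Group G] [Field Lbar] [Field Kv]
  [Group Pi'] [Group G'] [Field Lbar'] [Field Kv'] {D : StripDatum Pi G Lbar Kv} {D' : StripDatum Pi' G' Lbar' Kv'}
  (I : DatumIso D D')

/-- DERIVED: a datum isomorphism carries `O^▷_{L̄_v}` onto `O^▷_{L̄'_v}`. [claim: Joshi2024ATS3, status: disputed] -/
theorem mem_OTri_iff (x : Lbar) : I.fieldIso x ∈ D'.OTri ↔ x ∈ D.OTri := by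
  simp only [StripDatum.mem_OTri, I.map_abs, map_ne_zero_iff _ I.fieldIso.injective]

/-- DERIVED: the induced monoid isomorphism `O^▷_{L̄_v} ≃ O^▷_{L̄'_v}`. [claim: Joshi2024ATS3, status: disputed] -/
def oTriIso : D.OTri ≃* D'.OTri where
  toFun x := ⟨I.fieldIso x, (I.mem_OTri_iff x).2 x.2⟩
  invFun x := ⟨I.fieldIso.symm x, (I.mem_OTri_iff _).1 (by simp)⟩
  left_inv x := Subtype.ext (by simp)
  right_inv x := Subtype.ext (by simp)
  map_mul' x y := Subtype.ext (by simp only [Submonoid.coe_mul, map_mul])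

/-- **PROVED (functoriality clause of Thm. 8.8.3 / (8.8.4) at the level of `O^▷`)**: a datum isomorphism induces a
strip isomorphism `G_{L_v} ↷ O^▷_{L̄_v} ⥲ G_{L^σ_v} ↷ O^▷_{L̄^σ_v}`; the `F^{⊢×}` / `F^{⊢×μ}` rows follow by OUR functorial
passages `unitsAct` / `unitsModTorsionAct`. [claim: Joshi2024ATS3, status: disputed] -/
def stripIso : StripIso D.coveringMonoid D'.coveringMonoid where
  groupIso := I.groupIso
  monoidIso := I.oTriIso
  map_act g x := Subtype.ext (I.map_gal g x.1)

end DatumIso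

end Summit.ABC.IUTFork.Joshi.ATS3
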